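import Summits.ResolutionOfSingularities.ResolutionOfSingularities.Theorems.PurelyInseparableDim4ResConePrimeShadeTail
import Summits.ResolutionOfSingularities.ResolutionOfSingularities.Theorems.PurelyInseparableDim4ResConeHeavyPermanentSet
import Summits.ResolutionOfSingularities.ResolutionOfSingularities.Theorems.PurelyInseparableDim4ResConeLightTripleAllPrimes
import HarnessLib
import HarnessLib.Audit.Tags

/-!
# Purely inseparable four-folds — TAIL(p, p−2, 2) IS EMPTY FOR EVERY PRIME `p`: no witnessed isolated above-floor `Step0 p`
# chain has constant shade `p − 2` and binary residual cone (`e_G ≡ 2`) — the one-tracked-frame assembly at threshold `2`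
# (cell `res-dim4-pi`, K2(p) lane; rung-0 exit table: the whole `(7,5)` binary-cone slot A4–A7 CLOSED for every prime)

[OURS · counted 0 · cell `res-dim4-pi` · K2(p) lane holder res-dim4-p-12 g5.]  **HONEST LABEL.**  A theorem about OUR MODEL (the
coordinate point-blow-up walk `Step0 p` with cleaning on presented states `(F, r, exc)` of `z^p + F(x₁..x₄)`, ISOLATED regime):
it empties a SECOND of the `2·(p − 3)` tail statements of the K2(p) ledger (`noAboveFloorTrap_iff_highTails`, p710010) for every
prime at once — the slot `(d, e) = (p − 2, 2)` (the first, `(p − 1, 2)`, is `…ResConePrimeShadeTail`).  Nothing here proves K2(p)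
for any `p ≥ 7` (six of the eight tails at `p = 7` remain: TAIL(7,3,2), TAIL(7,4,2) and the four power cones), `NoIsolatedTrap p p`,
CJS Key Theorem 6.40 or resolution of singularities in dimension ≥ 4 / characteristic `p` — NOT proved.  AI kernel work, weaker than
expert review.

THE THRESHOLD.  At shade `d` a boundary letter of weight `w` sits on a Φ-line iff `w ≥ t := p − d` (`n = p − w ≤ d`).  The
one-tracked-frame argument of `…ResConePrimeShadeTail` (§2 there, `no_tail_of_tracked_frame`: a frame that follows every HIT onto
the newborn and stays on every KEEP is kept only `βs₀` times, so the tracked letter is eventually hit at every step — a FREE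
tail, against FT via res-dim4-p-7 g3's moving dock) needs every letter it visits to weigh `≥ t`.  A kept letter keeps its weight; a
newborn weighs `|r_k| − t`.  THE ARITHMETIC OF `t = 2` (§1, `degree_succ_add_le_of_hit`): when a letter `h` of weight `≥ t` is hit
at `k`, the child's mass is at most `(|r_k| − t) + (|r_k| − r_k h) ≤ 2|r_k| − 2t`, and the band at the child demands `≥ t + 1`;
for `t = 2` this forces `|r_k| ≥ 4`, i.e. the newborn weighs `≥ 2 = t` — the frame CAN follow.  (For `t = 1` the newborn always
weighs `≥ 1`: `…PrimeShadeTail`.  For `t ≥ 3` the same count allows a newborn of weight `< t` — e.g. `(3,2) → (2,2)` at `(7,4)` —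
and the argument stops: the honest frontier.)

THE START (§2).  By res-dim4-p-1 g6's `binaryCone_eventually_heavy` (every prime, every shade `d < p`) some letter weighs `≥ 2` at
every late time; if no letter of weight `≥ 2` is ever hit after that, the weight-`≥ 2` letter present then is PERMANENT with frozen
weight `≥ 2 = p − d` — excluded by res-dim4-p-5 g5's ledger theorem `no_tail_of_permanent_heavy_letter` (mass never drops and rises
at every satellite step; FT).  So some step hits a letter of weight `≥ 2`: E (res-dim4-p-9 g5 `heavy_entryFrame`, `n := p − w`) +
L (res-dim4-p-2 g6 `tail_heavy_lose_step`, `n := p − w′`, `w′ ≥ 2` by §1) frame the newborn, and the tracker runs with run datum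
«weight `≥ 2` + frame + `0 < αs`», `Φ := βs`, (L) = `tail_heavy_lose_step` + §1, (K) = res-dim4-p-7 g5's `tail_heavy_keep_step`
(`n := p − r_k h ∈ [1, d]`).

**`no_subTwoShade_binaryCone_tail (p)`: TAIL(p, p−2, 2) = ∅ for every prime `p`** — unconditional in OUR frame.  At `p = 7` it is
the `(7,5)` binary-cone slot (exit-table rows A4 ZOO-118, A5 twin pair, A6 light triple, A7); at `p = 5` it re-proves TAIL-B
`(5,3)` (p706443/p707410) by a third route.

[cite: CossartJannsenSaito2020, Thm. 3.14, Lemma 13.4 (3), Thm. 13.7] [cite: CossartPiltant2008, (16), Lemma 4.5 (2)]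
[cite: HauserPerlega2019PRIMS, §2 (transform D′ of D)]
bears_on: LADDER-RESOLUTION:D157-DOOR2 (res-dim4-pi · K2(p) · TAIL(p, p−2, 2) = ∅ ∀ p · exit-table rows A4–A7).  Supports
stmt-ResolutionOfSingularities-16155 (helper).
-/

set_option linter.dupNamespace false -- mandated namespace of this single-conjunct summit

noncomputable section

namespace Summit.ResolutionOfSingularities.ResolutionOfSingularities.Theorems.PIDim4

namespace ResCone

open MvPolynomial Finset
open Literature.AlgebraicGeometry.Resolution
open Literature.AlgebraicGeometry.Resolution.CentreBlowup
open Literature.AlgebraicGeometry.Resolution.Hauser2010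
open Literature.AlgebraicGeometry.Resolution.HauserPerlega2019
open Literature.AlgebraicGeometry.Resolution.WeightedOrder
open PointBlowup (direction)

variable {K : Type} [Field K]

/-! ## 1. The mass after a hit (weights + band only) -/

section Mass

variable (p : ℕ) [hp : Fact p.Prime] [DecidableEq K]

/-- **THE MASS AFTER A HIT.**  Along a witnessed isolated above-floor `Step0 p` chain with `x^{r₀} ∣ F₀` and constant shade `d` from
`k₀`: if step `k ≥ k₀` hits (charts or translates) the letter `h`, then `|r_{k+1}| + r_k h ≤ |r_k| + (|r_k| + d − p)` — the child
carries the newborn and at most the old mass minus the hit letter's weight. [OURS · bookkeeping]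
[cite: HauserPerlega2019PRIMS, §2 (transform D′ of D)] -/
theorem degree_succ_add_le_of_hit {c : ℕ → State K} {j : ℕ → Fin 4} {b : ℕ → Fin 4 → K}
    (hc : ∀ k, IsIsolated p (c k).F ∧ Step0 p (c k) (c (k + 1))) (hw : FreeTail.IsWitnessedChain p c j b)
    (hr0 : ∀ e ∈ (c 0).F.support, (c 0).r ≤ e) (hfloor : ∀ k, ordZero (c k).F ≠ p) {k₀ d : ℕ}
    (hshade : ∀ k, k₀ ≤ k → (c k).shade = (d : ℕ∞)) {k : ℕ} (hk : k₀ ≤ k) {h : Fin 4} (hhit : j k = h ∨ b k h ≠ 0) :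
    (c (k + 1)).r.degree + (c k).r h ≤ (c k).r.degree + ((c k).r.degree + d - p) := by
  classical
  obtain ⟨-, hlaw, -, -, -⟩ := tail_weights_laws hc hw hr0 hfloor hshade
  have hr1 := hlaw k hk
  have hnew : (c (k + 1)).r (j k) = (c k).r.degree + d - p := by rw [hr1, Finsupp.coe_update, Function.update_self]
  have hoth : ∀ i, i ≠ j k → (c (k + 1)).r i = if b k i = 0 then (c k).r i else 0 := fun i hi => by
    rw [hr1, Finsupp.coe_update, Function.update_of_ne hi, Finsupp.filter_apply]
  -- pointwise: off the chart, the child weighs at most `r_k i`, and `0` at `h` (if `h` is not the chart it was translated)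
  have hpt : ∀ i ∈ (Finset.univ : Finset (Fin 4)).erase (j k),
      (c (k + 1)).r i ≤ if i = h then 0 else (c k).r i := by
    intro i hi
    have hij : i ≠ j k := (Finset.mem_erase.mp hi).1
    rw [hoth i hij]
    by_cases hih : i = h
    · rw [if_pos hih]
      have hbh : b k h ≠ 0 := by
        rcases hhit with hjh | hbh
        · exact absurd (hih ▸ hjh.symm) hij
        · exact hbh
      rw [hih, if_neg hbh]
    · rw [if_neg hih]
      split_ifs <;> simp
  have h1 : ∑ i ∈ (Finset.univ : Finset (Fin 4)).erase (j k), (c (k + 1)).r i ≤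
      ∑ i ∈ (Finset.univ : Finset (Fin 4)).erase (j k), (if i = h then 0 else (c k).r i) := Finset.sum_le_sum hpt
  have h2 : ∑ i ∈ (Finset.univ : Finset (Fin 4)).erase (j k), (if i = h then 0 else (c k).r i) ≤
      ∑ i, (if i = h then 0 else (c k).r i) :=
    Finset.sum_le_sum_of_subset_of_nonneg (Finset.erase_subset _ _) fun _ _ _ => Nat.zero_le _
  have h3 : (∑ i, (if i = h then 0 else (c k).r i)) + (c k).r h = ∑ i, (c k).r i := by
    rw [← Finset.add_sum_erase _ _ (Finset.mem_univ h), if_pos rfl, zero_add,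
      ← Finset.add_sum_erase _ (fun i => (c k).r i) (Finset.mem_univ h), add_comm]
    congr 1
    exact Finset.sum_congr rfl fun i hi => by rw [if_neg (Finset.mem_erase.mp hi).1]
  have h4 : ∑ i, (c (k + 1)).r i = (c (k + 1)).r (j k) + ∑ i ∈ (Finset.univ : Finset (Fin 4)).erase (j k), (c (k + 1)).r i :=
    (Finset.add_sum_erase _ _ (Finset.mem_univ (j k))).symm
  rw [Finsupp.degree_eq_sum ((c (k + 1)).r), h4, hnew]
  have h5 : (c k).r.degree = ∑ i, (c k).r i := Finsupp.degree_eq_sum _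
  omega

end Mass

/-! ## 2. TAIL(p, p−2, 2) = ∅ -/

section SubTwo

variable (p : ℕ) [hp : Fact p.Prime] [CharP K p] [DecidableEq K]

/-- **TAIL(p, p−2, 2) IS EMPTY FOR EVERY PRIME `p`.**  There is no witnessed isolated above-floor `Step0 p` chain `c j b` with
`x^{r₀} ∣ F₀` whose shade is `≡ d = p − 2` and whose polar-kernel rank is `e_G ≡ 2` from some time `k₀` on.  START: res-dim4-p-1 g6's
`binaryCone_eventually_heavy` + res-dim4-p-5 g5's `no_tail_of_permanent_heavy_letter` give a step hitting a letter of weight `≥ 2`;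
E (`heavy_entryFrame`, `n := p − w`) + L (`tail_heavy_lose_step`, `n := p − w′`) frame the newborn, which weighs `≥ 2` by
`degree_succ_add_le_of_hit` and the band at the child.  RUN: `no_tail_of_tracked_frame` with run datum «`2 ≤ r_k h` + frame +
`0 < αs`», `Φ := βs`; (L) the newborn of a hit weight-`≥ 2` letter weighs `≥ 2` (§1 + band); (K) `tail_heavy_keep_step` with
`n := p − r_k h ∈ [1, d]`.  Unconditional; no class binder. [OURS] [cite: CossartJannsenSaito2020, Thm. 3.14, Lemma 13.4 (3), Thm. 13.7]
[cite: CossartPiltant2008, (16), Lemma 4.5 (2)] -/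
theorem no_subTwoShade_binaryCone_tail {c : ℕ → State K} {j : ℕ → Fin 4} {b : ℕ → Fin 4 → K}
    (hc : ∀ k, IsIsolated p (c k).F ∧ Step0 p (c k) (c (k + 1))) (hw : FreeTail.IsWitnessedChain p c j b)
    (hr0 : ∀ e ∈ (c 0).F.support, (c 0).r ≤ e) (hfloor : ∀ k, ordZero (c k).F ≠ p) {k₀ d : ℕ} (hdp : d + 2 = p)
    (hshade : ∀ k, k₀ ≤ k → (c k).shade = (d : ℕ∞))
    (he : ∀ k, k₀ ≤ k → Module.finrank K (resVertex (c k)) = 2) : False := by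
  classical
  have hdp' : d < p := by omega
  obtain ⟨-, hlaw, hbj, hband, hpair⟩ := tail_weights_laws hc hw hr0 hfloor hshade
  -- every weight is `≤ p − 2`
  have hle : ∀ k (i : Fin 4), (c k).r i ≤ p - 2 := by
    intro k i
    obtain ⟨i', hi'⟩ := exists_ne i
    have := hpair k i i' (Ne.symm hi')
    omega
  -- a kept letter keeps its weight
  have hkept : ∀ k, k₀ ≤ k → ∀ (h : Fin 4), j k ≠ h → b k h = 0 → (c (k + 1)).r h = (c k).r h := by
    intro k hk h hjh hbh
    rw [hlaw k hk, Finsupp.coe_update, Function.update_of_ne (Ne.symm hjh),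
      Finsupp.filter_apply_pos (fun i => b k i = 0) ((c k).r) hbh]
  -- the threshold-2 arithmetic: a hit of a weight-`≥ 2` letter forces `|r_k| ≥ 4`, so the newborn weighs `≥ 2`
  have hfour : ∀ k, k₀ ≤ k → ∀ (h : Fin 4), 2 ≤ (c k).r h → (j k = h ∨ b k h ≠ 0) → 4 ≤ (c k).r.degree := by
    intro k hk h hh2 hhit
    have hmass := degree_succ_add_le_of_hit p hc hw hr0 hfloor hshade hk hhit
    obtain ⟨hpo₁, -⟩ := hband (k + 1) (by omega)
    obtain ⟨hpo, ho2⟩ := hband k hk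
    omega
  -- START: some step hits a letter of weight `≥ 2`
  have hstart : ∃ k, k₀ ≤ k ∧ ∃ W : Fin 4, 2 ≤ (c k).r W ∧ (j k = W ∨ b k W ≠ 0) := by
    obtain ⟨k₁, hk₁, hheavy⟩ := binaryCone_eventually_heavy p hc hw hr0 hfloor hdp' hshade he
    by_contra hno
    push Not at hno
    obtain ⟨W, hW⟩ := hheavy k₁ le_rfl
    -- `W` is then permanent with frozen weight `≥ 2`
    have hfrozen : ∀ m, k₁ ≤ m → (c m).r W = (c k₁).r W ∧ (j m ≠ W ∧ b m W = 0) := by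
      intro m hm
      induction m, hm using Nat.le_induction with
      | base => exact ⟨rfl, hno k₁ hk₁ W hW⟩
      | succ m hm ih =>
        obtain ⟨hrm, hjm, hbm⟩ := ih
        have hrm1 : (c (m + 1)).r W = (c k₁).r W := by rw [hkept m (by omega) W hjm hbm, hrm]
        exact ⟨hrm1, hno (m + 1) (by omega) W (by rw [hrm1]; exact hW)⟩
    exact no_tail_of_permanent_heavy_letter p hc hw hr0 hfloor hshade hk₁ (h := W) (fun m hm => (hfrozen m hm).2)
      (by omega)
  obtain ⟨k₁, hk₁, W, hW2, hhit⟩ := hstart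
  obtain ⟨hpo₁, ho2₁⟩ := hband k₁ hk₁
  have hfour₁ := hfour k₁ hk₁ W hW2 hhit
  -- E at `k₁` on `W` (`n := p − r W`), then L across step `k₁` (`n := p − newborn weight`)
  obtain ⟨L₀, M₀, hM₀, hL₀u1, hy₀, hne₀, hδ₀, -⟩ := heavy_entryFrame (p := p) (d := d) (n := p - (c k₁).r W) hdp'
    (by have := hle k₁ W; omega) hc hw hr0 hfloor hshade he hk₁ (W := W) (by omega)
    (heavyLine_direction_ne_zero (hbj k₁) hhit)
  obtain ⟨L₁, M₁, ⟨hM₁, hL₁u1, hy₁, hne₁, hδ₁, -⟩, hpos₁, -⟩ := tail_heavy_lose_step (p := p) (d := d)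
    (n := p - ((c k₁).r.degree + d - p)) hdp' (by omega) hc hw hr0 hfloor hshade he hk₁ (by omega)
    (heavyLine_direction_ne_zero (hbj k₁) hhit) hM₀ hL₀u1 hy₀ hne₀ hδ₀
  obtain ⟨hnew₁, -, -, -⟩ := tail_newborn_weight hc hw hr0 hfloor hshade hk₁
  -- RUN: the tracker with threshold `2`
  refine no_tail_of_tracked_frame p hc hw (k₁ := k₁ + 1)
    (Fr := (Fin (2 + 2) → Fin 4 → K) × (Fin 4 → Fin (2 + 2) → K))
    (fun k i f => 2 ≤ (c k).r i ∧
      (∀ t u, ∑ s, f.2 t s * f.1 s u = if t = u then 1 else 0) ∧ f.1 (u1 2) = Pi.single i 1 ∧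
      (∀ s, s ≠ u1 2 → s ≠ u2 2 → ∀ w ∈ resVertex (c k), ∑ t, f.1 s t * w t = 0) ∧
      (pts (fun s => algebraMap (MvPolynomial (Fin 4) K) (OriginLocalization K 4) (∑ t, C (f.1 s t) * X t))
        (Ideal.span {algebraMap (MvPolynomial (Fin 4) K) (OriginLocalization K 4)
            ((c k).F.divMonomial (c k).r)}) d).Nonempty ∧
      Nat.factorial d < deltaS (fun s => algebraMap (MvPolynomial (Fin 4) K) (OriginLocalization K 4) (∑ t, C (f.1 s t) * X t))
        (Ideal.span {algebraMap (MvPolynomial (Fin 4) K) (OriginLocalization K 4)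
            ((c k).F.divMonomial (c k).r)}) d ∧
      0 < alphaS (fun s => algebraMap (MvPolynomial (Fin 4) K) (OriginLocalization K 4) (∑ t, C (f.1 s t) * X t))
        (Ideal.span {algebraMap (MvPolynomial (Fin 4) K) (OriginLocalization K 4)
            ((c k).F.divMonomial (c k).r)}) d)
    (fun k f => betaS (fun s => algebraMap (MvPolynomial (Fin 4) K) (OriginLocalization K 4) (∑ t, C (f.1 s t) * X t))
        (Ideal.span {algebraMap (MvPolynomial (Fin 4) K) (OriginLocalization K 4)
            ((c k).F.divMonomial (c k).r)}) d)
    ?_ ?_ (h₀ := j k₁) (f₀ := ⟨L₁, M₁⟩) ⟨by rw [hnew₁]; omega, hM₁, hL₁u1, hy₁, hne₁, hδ₁, hpos₁⟩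
  · -- (L): the frame follows the hit onto the newborn, which weighs `≥ 2` (threshold arithmetic)
    rintro k hk h ⟨L, M⟩ ⟨hw2, hM, hLu1, hy, hne, hδ, -⟩ hhit'
    have hk0 : k₀ ≤ k := by omega
    obtain ⟨hpo, ho2⟩ := hband k hk0
    have hfourk := hfour k hk0 h hw2 hhit'
    obtain ⟨L', M', ⟨hM', hL'u1, hy', hne', hδ', -⟩, hpos', hle'⟩ := tail_heavy_lose_step (p := p) (d := d)
      (n := p - ((c k).r.degree + d - p)) hdp' (by omega) hc hw hr0 hfloor hshade he hk0 (by omega)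
      (heavyLine_direction_ne_zero (hbj k) hhit') hM hLu1 hy hne hδ
    obtain ⟨hnew, -, -, -⟩ := tail_newborn_weight hc hw hr0 hfloor hshade hk0
    exact ⟨⟨L', M'⟩, ⟨by rw [hnew]; omega, hM', hL'u1, hy', hne', hδ', hpos'⟩, hle'⟩
  · -- (K): the frame stays on the kept letter, `βs` drops (`n := p − r_k h ∈ [1, d]`)
    rintro k hk h ⟨L, M⟩ ⟨hw2, hM, hLu1, hy, hne, hδ, hα0⟩ hjh hbh
    have hk0 : k₀ ≤ k := by omega
    have hrle := hle k h
    obtain ⟨L', M', ⟨hM', hL'u1, hy', hne', hδ', -⟩, hpos', hlt'⟩ := tail_heavy_keep_step (p := p) (d := d)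
      (n := p - (c k).r h) hdp' (by omega) (by omega) hc hw hr0 hfloor hshade he hk0 (h := h) (by omega) hjh hbh
      hM hLu1 hy hne hδ hα0
    exact ⟨⟨L', M'⟩, ⟨by rw [hkept k hk0 h hjh hbh]; exact hw2, hM', hL'u1, hy', hne', hδ', hpos'⟩, hlt'⟩

end SubTwo

end ResCone

end Summit.ResolutionOfSingularities.ResolutionOfSingularities.Theorems.PIDim4

end
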